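import Literature.Topology.FourManifolds.SurfaceGroupNielsenSetup
import Literature.Topology.FourManifolds.SurfaceGroupHomology
import HarnessLib

/-!
# The surface relator is a simple circuit in the Cayley graph of `S_g`

Topic `Literature/Topology/FourManifolds`.  Support for pillar (B) (planar counting, ZVC
Thm. 5.4.2 / Cor. 5.4.3) of Zieschang's proof of Nielsen's theorem
(`SurfaceGroupNielsenSetup.lean`): the faces of the Cayley `2`-complex of
`S_g = ⟨a₀, b₀, …, a_{g-1}, b_{g-1} ∣ r_g = ∏ [aᵢ, bᵢ]⟩` are the translates of the closed edge
path reading the relator word `r_g = surfaceWordStd g = a₀ b₀ a₀⁻¹ b₀⁻¹ a₁ ⋯`, and the counting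
argument needs this closed path to be **simple**: its `4g` vertices
`proj (mk (r_g.take k))`, `k < 4g`, are pairwise distinct in `S_g`
(`isSimpleCircuit_surfaceWordStd`); equivalently every contiguous proper sub-word `r_g[k, l)`
is non-trivial in `S_g` (`proj_mk_slice_surfaceWordStd_ne_one`).

The proof: the prefix of length `4m + t` (`t < 4`) is `∏_{i<m} [aᵢ, bᵢ]` times the first `t`
letters of block `m` (`take_surfaceWordStd`).  The abelianisation `S_g → ℤ^{2g}` of a prefix is
the exponent-sum vector `0, e_{aₘ}, e_{aₘ} + e_{bₘ}, e_{bₘ}` of the partial block, which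
determines `(m, t)` unless `t = 0` (`abelVec_inj`); the block products `∏_{i<m} [aᵢ, bᵢ]`,
`m < g`, are separated by a representation `S_g → Heis` in the integer Heisenberg group
(`circHom`: `aᵢ ↦ (1, 0, 0)`, `bᵢ ↦ (0, ηᵢ, 0)` with `ηᵢ = 1` for `i < g - 1`,
`η_{g-1} = 1 - g`, so that the relator dies), under which `∏_{i<m} [aᵢ, bᵢ]` has central
coordinate `m` (`circHom_proj_prod_take`).  Also here: the relator word is reduced
(`isReduced_surfaceWordStd`), generators are non-trivial in `S_g` (`proj_of_ne_one`), and `S_g`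
is infinite for `g ≥ 1` (`infinite_surfaceGroup`), both by abelianising.

## References

* H. Zieschang, E. Vogt, H.-D. Coldewey, *Surfaces and Planar Discontinuous Groups*, LNM 835,
  Springer (1980), §5.3 (5.3.1 (c)), §5.4 (Thm. 5.4.2, Cor. 5.4.3). [ZieschangVogtColdewey1980]
-/

noncomputable section

namespace Literature.Topology.FourManifolds

open Literature.GroupTheory.CombinatorialGroupTheory List

namespace SurfaceGroup

variable {g : ℕ}

/-! ## The blocks of the relator word -/

/-- The block word `aᵢ bᵢ aᵢ⁻¹ bᵢ⁻¹` of handle `i`. [folklore] -/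
def handleBlock (i : Fin g) : List (surfaceGen g × Bool) :=
  [((i, false), true), ((i, true), true), ((i, false), false), ((i, true), false)]

/-- The commutator `[aᵢ, bᵢ] = aᵢ bᵢ aᵢ⁻¹ bᵢ⁻¹` of handle `i`. [folklore] -/
def handleComm (i : Fin g) : FreeGroup (surfaceGen g) := genA i * genB i * (genA i)⁻¹ * (genB i)⁻¹

/-- The relator word is the concatenation of the block words. [folklore] -/
theorem surfaceWordStd_eq_flatMap (g : ℕ) : surfaceWordStd g = (finRange g).flatMap handleBlock := rfl

/-- The relator is the ordered product of the handle commutators. [folklore] -/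
theorem surfaceRelator_eq_prod_handleComm (g : ℕ) :
    surfaceRelator g = ((finRange g).map handleComm).prod := rfl

/-- A block word has four letters. [folklore] -/
theorem length_handleBlock (i : Fin g) : (handleBlock i).length = 4 := rfl

/-- The block word spells the handle commutator. [folklore] -/
theorem mk_handleBlock (i : Fin g) : FreeGroup.mk (handleBlock i) = handleComm i := rfl

/-- A concatenation of block words spells the product of the commutators. [folklore] -/
theorem mk_flatMap_handleBlock (l : List (Fin g)) :
    FreeGroup.mk (l.flatMap handleBlock) = (l.map handleComm).prod := by
  induction l with
  | nil => rfl
  | cons i l ih => rw [flatMap_cons, ← FreeGroup.mul_mk, ih, map_cons, prod_cons]; rfl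

/-- The prefix of length `4m + t` (`t ≤ 4`) of a concatenation of block words: the first `m`
blocks followed by the first `t` letters of block number `m`. [folklore] -/
theorem take_flatMap_handleBlock (l : List (Fin g)) {m t : ℕ} (hm : m < l.length) (ht : t ≤ 4) :
    (l.flatMap handleBlock).take (4 * m + t) =
      (l.take m).flatMap handleBlock ++ (handleBlock l[m]).take t := by
  induction l generalizing m with
  | nil => simp at hm
  | cons i l ih =>
    cases m with
    | zero =>
      rw [flatMap_cons, Nat.mul_zero, Nat.zero_add,
        take_append_of_le_length (by rw [length_handleBlock]; exact ht)]
      simp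
    | succ m =>
      rw [flatMap_cons, take_append, take_of_length_le (by rw [length_handleBlock]; omega),
        length_handleBlock, show 4 * (m + 1) + t - 4 = 4 * m + t by omega, ih (by simpa using hm)]
      simp

/-! ## The relator word is reduced -/

/-- Inside a block adjacent letters have distinct symbols. [folklore] -/
theorem isChain_handleBlock (i : Fin g) : (handleBlock i).IsChain (fun x y => x.1 ≠ y.1) := by
  simp [handleBlock]

/-- The last letter of a block is `bᵢ⁻¹`. [folklore] -/
theorem getLast?_handleBlock (i : Fin g) : (handleBlock i).getLast? = some ((i, true), false) := rfl

/-- A non-empty concatenation of blocks starts with a letter `aⱼ`. [folklore] -/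
theorem head?_flatMap_handleBlock (l : List (Fin g)) (y : surfaceGen g × Bool)
    (hy : y ∈ (l.flatMap handleBlock).head?) : y.1.2 = false := by
  cases l with
  | nil => simp at hy
  | cons j l =>
    rw [flatMap_cons, show (handleBlock j ++ l.flatMap handleBlock).head? = some ((j, false), true) from rfl,
      Option.mem_some_iff] at hy
    rw [← hy]

/-- In a concatenation of block words adjacent letters have distinct symbols. [folklore] -/
theorem isChain_flatMap_handleBlock (l : List (Fin g)) :
    (l.flatMap handleBlock).IsChain (fun x y => x.1 ≠ y.1) := by
  induction l with
  | nil => simp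
  | cons i l ih =>
    rw [flatMap_cons]
    refine (isChain_handleBlock i).append ih fun x hx y hy h => ?_
    rw [getLast?_handleBlock, Option.mem_some_iff] at hx
    have h1 := head?_flatMap_handleBlock l y hy
    rw [← h, ← hx] at h1
    exact Bool.noConfusion h1

/-- **The relator word `r_g` is reduced.** [folklore] -/
theorem isReduced_surfaceWordStd (g : ℕ) : FreeGroup.IsReduced (surfaceWordStd g) := by
  rw [surfaceWordStd_eq_flatMap]
  exact (isChain_flatMap_handleBlock _).imp fun a b h h' => absurd h' h

/-! ## Abelianising: generators are non-trivial, `S_g` is infinite -/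

/-- The abelianisation of the class of `x ∈ F` is the exponent-sum vector of `x`. [folklore] -/
theorem abelianize_proj (x : FreeGroup (surfaceGen g)) :
    abelianize g (proj g x) = FreeGroup.lift (fun y => Multiplicative.ofAdd (Pi.single y (1 : ℤ))) x := rfl

/-- **The generators `aᵢ, bᵢ` are non-trivial in `S_g`** (their abelianisations are basis
vectors). [folklore] -/
theorem proj_of_ne_one {g : ℕ} (x : surfaceGen g) : proj g (FreeGroup.of x) ≠ 1 := by
  intro h
  have h1 := congrArg (fun z => Multiplicative.toAdd (abelianize g z) x) h
  simp [abelianize_proj] at h1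

/-- **`S_g` is infinite for `g ≥ 1`**: the powers of `a₀` are pairwise distinct (abelianise).
[folklore] -/
theorem infinite_surfaceGroup {g : ℕ} (hg : 1 ≤ g) : Infinite (SurfaceGroup g) := by
  refine Infinite.of_injective (fun n : ℤ => proj g (FreeGroup.of (⟨0, hg⟩, false)) ^ n) fun m n hmn => ?_
  have h1 := congrArg (fun z => Multiplicative.toAdd (abelianize g z) (⟨0, hg⟩, false)) hmn
  simpa [abelianize_proj] using h1

/-! ## Prefixes of the relator word -/

/-- The prefix of length `4m + t` (`t ≤ 4`, `m < g`) of the relator word: the first `m` blocks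
followed by the first `t` letters of block `m`. [folklore] -/
theorem take_surfaceWordStd {m t : ℕ} (hm : m < g) (ht : t ≤ 4) :
    (surfaceWordStd g).take (4 * m + t) =
      ((finRange g).take m).flatMap handleBlock ++ (handleBlock ⟨m, hm⟩).take t := by
  rw [surfaceWordStd_eq_flatMap, take_flatMap_handleBlock _ (by simpa using hm) ht, getElem_finRange]
  rfl

/-- The value in `S_g` of the prefix of length `4m + t`: `∏_{i<m} [aᵢ, bᵢ]` times the partial
block. [folklore] -/
theorem proj_mk_take_surfaceWordStd {m t : ℕ} (hm : m < g) (ht : t ≤ 4) :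
    proj g (FreeGroup.mk ((surfaceWordStd g).take (4 * m + t))) =
      proj g (((finRange g).take m).map handleComm).prod *
        proj g (FreeGroup.mk ((handleBlock ⟨m, hm⟩).take t)) := by
  rw [take_surfaceWordStd hm ht, ← FreeGroup.mul_mk, map_mul, mk_flatMap_handleBlock]

/-! ## The abelianisation of the prefixes -/

/-- The abelianisation kills every product of handle commutators. [folklore] -/
theorem abelianize_proj_prod_handleComm (l : List (Fin g)) :
    abelianize g (proj g ((l.map handleComm).prod)) = 1 := by
  rw [map_list_prod, map_list_prod, List.map_map, List.map_map]
  refine List.prod_eq_one fun x hx => ?_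
  rw [List.mem_map] at hx
  obtain ⟨i, -, rfl⟩ := hx
  simp only [Function.comp_apply, handleComm, map_mul, map_inv]
  rw [mul_inv_eq_one, mul_inv_eq_iff_eq_mul]
  exact mul_comm _ _

/-- The exponent-sum vector of the first `t` letters of block `m`: `0`, `e_{aₘ}`, `e_{aₘ} + e_{bₘ}`,
`e_{bₘ}` for `t = 0, 1, 2, 3`. [folklore] -/
def abelVec (m : Fin g) (t : ℕ) : surfaceGen g → ℤ :=
  (if t = 1 ∨ t = 2 then Pi.single (m, false) 1 else 0) +
    (if t = 2 ∨ t = 3 then Pi.single (m, true) 1 else 0)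

/-- `abelVec` at an `a`-coordinate. [folklore] -/
theorem abelVec_apply_false (m j : Fin g) (t : ℕ) :
    abelVec m t (j, false) = if j = m ∧ (t = 1 ∨ t = 2) then 1 else 0 := by
  unfold abelVec
  by_cases h : t = 1 ∨ t = 2 <;> by_cases h' : t = 2 ∨ t = 3 <;> by_cases hj : j = m <;>
    simp [h, h', hj]

/-- `abelVec` at a `b`-coordinate. [folklore] -/
theorem abelVec_apply_true (m j : Fin g) (t : ℕ) :
    abelVec m t (j, true) = if j = m ∧ (t = 2 ∨ t = 3) then 1 else 0 := by
  unfold abelVec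
  by_cases h : t = 1 ∨ t = 2 <;> by_cases h' : t = 2 ∨ t = 3 <;> by_cases hj : j = m <;>
    simp [h, h', hj]

/-- The exponent-sum vector of a partial block determines the partial block, except that all
empty partial blocks have the same (zero) vector. [folklore] -/
theorem abelVec_inj {m m' : Fin g} {t t' : ℕ} (ht : t < 4) (ht' : t' < 4) (h : abelVec m t = abelVec m' t') :
    (t = 0 ∧ t' = 0) ∨ (m = m' ∧ t = t') := by
  have h1 := congrFun h (m, false)
  have h2 := congrFun h (m, true)
  have h3 := congrFun h (m', false)
  have h4 := congrFun h (m', true)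
  simp only [abelVec_apply_false, abelVec_apply_true, true_and] at h1 h2 h3 h4
  by_cases hmm : m = m'
  · subst hmm
    simp only [true_and] at h1 h2
    by_cases h0 : t = 0 ∧ t' = 0
    · exact Or.inl h0
    · refine Or.inr ⟨rfl, ?_⟩
      split_ifs at h1 h2 <;> omega
  · have hmm' : ¬ m' = m := fun h => hmm h.symm
    simp only [hmm', false_and, if_false] at h1 h2 h3 h4
    left
    split_ifs at h1 h2 h3 h4 <;> omega

/-- The abelianisation of the first `t` letters of block `m` is `abelVec m t`. [folklore] -/
theorem toAdd_abelianize_proj_mk_take_handleBlock (m : Fin g) {t : ℕ} (ht : t < 4) :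
    Multiplicative.toAdd (abelianize g (proj g (FreeGroup.mk ((handleBlock m).take t)))) = abelVec m t := by
  interval_cases t
  · simp [handleBlock, abelVec, abelianize_proj, FreeGroup.lift_mk]
  · simp [handleBlock, abelVec, abelianize_proj, FreeGroup.lift_mk]
  · simp [handleBlock, abelVec, abelianize_proj, FreeGroup.lift_mk]
  · simp [handleBlock, abelVec, abelianize_proj, FreeGroup.lift_mk]

/-- **The abelianisation of the prefix of length `4m + t` is `abelVec m t`.** [folklore] -/
theorem toAdd_abelianize_proj_mk_take {m t : ℕ} (hm : m < g) (ht : t < 4) :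
    Multiplicative.toAdd (abelianize g (proj g (FreeGroup.mk ((surfaceWordStd g).take (4 * m + t))))) =
      abelVec ⟨m, hm⟩ t := by
  rw [proj_mk_take_surfaceWordStd hm ht.le, map_mul, abelianize_proj_prod_handleComm, one_mul,
    toAdd_abelianize_proj_mk_take_handleBlock _ ht]

/-! ## A Heisenberg representation separating the block products -/

/-- The second weight of the separating Heisenberg representation: `aᵢ ↦ 0`, `bᵢ ↦ 1` for
`i < g - 1` and `b_{g-1} ↦ 1 - g` (the first weight is `ξ₀ = degXi g`: `aᵢ ↦ 1`, `bᵢ ↦ 0`).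
[folklore] -/
def circEta (g : ℕ) : surfaceGen g → ℤ :=
  fun x => if x.2 then (if (x.1 : ℕ) + 1 = g then 1 - (g : ℤ) else 1) else 0

/-- The symplectic pairing `ξ₀(aᵢ) η(bᵢ) - ξ₀(bᵢ) η(aᵢ) = η(bᵢ)` of the weights on handle `i`.
[folklore] -/
def circTerm (g : ℕ) (i : Fin g) : ℤ := if (i : ℕ) + 1 = g then 1 - (g : ℤ) else 1

/-- The pairings over all handles sum to zero (so the relator dies). [folklore] -/
theorem sum_circTerm (g : ℕ) : ∑ i : Fin g, circTerm g i = 0 := by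
  cases g with
  | zero => simp
  | succ n =>
    rw [Fin.sum_univ_castSucc]
    simp [circTerm, fun x : Fin n => (Nat.ne_of_lt x.is_lt : (x : ℕ) ≠ n)]

/-- The Heisenberg evaluation of a handle commutator is a commutator. [folklore] -/
theorem heisHom_handleComm (i : Fin g) :
    heisHom (degXi g) (circEta g) (handleComm i) =
      ⟨degXi g (i, false), circEta g (i, false), 0⟩ * ⟨degXi g (i, true), circEta g (i, true), 0⟩ *
        (⟨degXi g (i, false), circEta g (i, false), 0⟩ : Heis)⁻¹ *
          (⟨degXi g (i, true), circEta g (i, true), 0⟩ : Heis)⁻¹ := by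
  simp only [handleComm, genA, genB, map_mul, map_inv, heisHom_of]

/-- The Heisenberg evaluation of a product of handle commutators is central, with central
coordinate the sum of the pairings. [folklore] -/
theorem heisHom_prod_handleComm (l : List (Fin g)) :
    heisHom (degXi g) (circEta g) ((l.map handleComm).prod) = ⟨0, 0, (l.map (circTerm g)).sum⟩ := by
  induction l with
  | nil => rw [map_nil, prod_nil, map_one, map_nil, sum_nil]; rfl
  | cons i l ih =>
    rw [map_cons, prod_cons, map_mul, ih, heisHom_handleComm, map_cons, sum_cons]
    refine Heis.ext ?_ ?_ ?_
    · rw [Heis.mul_a, Heis.comm_a]; simp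
    · rw [Heis.mul_b, Heis.comm_b]; simp
    · rw [Heis.mul_c, Heis.comm_c, Heis.comm_a]
      simp [degXi, circEta, circTerm]

/-- The Heisenberg evaluation kills the relator. [folklore] -/
theorem heisHom_surfaceRelator_eq_one : heisHom (degXi g) (circEta g) (surfaceRelator g) = 1 := by
  rw [surfaceRelator_eq_prod_handleComm, heisHom_prod_handleComm, ← Fin.sum_univ_def, sum_circTerm]
  rfl

/-- **The separating Heisenberg representation** `S_g →* Heis`, `aᵢ ↦ (1, 0, 0)`,
`bᵢ ↦ (0, ηᵢ, 0)`. [folklore] -/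
def circHom (g : ℕ) : SurfaceGroup g →* Heis :=
  PresentedGroup.toGroup (f := fun x => (⟨degXi g x, circEta g x, 0⟩ : Heis)) (by
    rintro r hr
    rw [Set.mem_singleton_iff] at hr
    subst hr
    exact heisHom_surfaceRelator_eq_one)

/-- `circHom ∘ proj` is the Heisenberg evaluation. [folklore] -/
theorem circHom_proj (x : FreeGroup (surfaceGen g)) :
    circHom g (proj g x) = heisHom (degXi g) (circEta g) x := rfl

/-- The handles among the first `m` entries of `finRange g` have index `< m`. [folklore] -/
theorem val_lt_of_mem_take_finRange {m : ℕ} {i : Fin g} (hi : i ∈ (finRange g).take m) : (i : ℕ) < m := by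
  rw [mem_iff_getElem] at hi
  obtain ⟨n, hn, rfl⟩ := hi
  rw [length_take] at hn
  rw [getElem_take, getElem_finRange]
  simp only [Fin.val_cast]
  omega

/-- **The degree of the block products**: under the separating representation the central
coordinate of `∏_{i<m} [aᵢ, bᵢ]` is `m`, for `m < g`. [folklore] -/
theorem circHom_proj_prod_take {m : ℕ} (hm : m < g) :
    (circHom g (proj g ((((finRange g).take m).map handleComm).prod))).c = m := by
  rw [circHom_proj, heisHom_prod_handleComm]
  have key : ((finRange g).take m).map (circTerm g) = ((finRange g).take m).map fun _ => (1 : ℤ) := by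
    refine map_congr_left fun i hi => ?_
    have := val_lt_of_mem_take_finRange hi
    simp only [circTerm]
    rw [if_neg (by omega)]
  rw [key, map_const', sum_replicate, length_take, length_finRange]
  show min m g • (1 : ℤ) = m
  rw [min_eq_left hm.le, nsmul_eq_mul, mul_one]

/-! ## The relator word is a simple circuit -/

/-- **The proper prefixes of the relator word have pairwise distinct values in `S_g`**
(injectivity form). [cite: ZieschangVogtColdewey1980, §5.4] -/
theorem proj_mk_take_injective {k l : ℕ} (hk : k < 4 * g) (hl : l < 4 * g)
    (h : proj g (FreeGroup.mk ((surfaceWordStd g).take k)) = proj g (FreeGroup.mk ((surfaceWordStd g).take l))) :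
    k = l := by
  obtain ⟨m, t, ht, rfl⟩ : ∃ m t, t < 4 ∧ k = 4 * m + t :=
    ⟨k / 4, k % 4, Nat.mod_lt _ (by omega), (Nat.div_add_mod k 4).symm⟩
  obtain ⟨m', t', ht', rfl⟩ : ∃ m' t', t' < 4 ∧ l = 4 * m' + t' :=
    ⟨l / 4, l % 4, Nat.mod_lt _ (by omega), (Nat.div_add_mod l 4).symm⟩
  have hm : m < g := by omega
  have hm' : m' < g := by omega
  -- abelianise: the partial blocks have the same exponent sums
  have hab : abelVec ⟨m, hm⟩ t = abelVec ⟨m', hm'⟩ t' := by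
    rw [← toAdd_abelianize_proj_mk_take hm ht, ← toAdd_abelianize_proj_mk_take hm' ht', h]
  rcases abelVec_inj ht ht' hab with ⟨rfl, rfl⟩ | ⟨hmm, rfl⟩
  · -- both prefixes are block products: compare their degrees in the Heisenberg group
    rw [proj_mk_take_surfaceWordStd hm (by omega), proj_mk_take_surfaceWordStd hm' (by omega),
      take_zero, take_zero, ← FreeGroup.one_eq_mk, map_one, mul_one, mul_one] at h
    have h1 := congrArg (fun z => (circHom g z).c) h
    simp only [circHom_proj_prod_take hm, circHom_proj_prod_take hm', Nat.cast_inj] at h1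
    rw [h1]
  · simp only [Fin.mk.injEq] at hmm
    rw [hmm]

/-- The relator word is closed in `S_g`. [folklore] -/
theorem proj_mk_surfaceWordStd (g : ℕ) : proj g (FreeGroup.mk (surfaceWordStd g)) = 1 := by
  rw [mk_surfaceWordStd]
  exact mk_surfaceRelator

/-- **Distinct prefixes**: two prefixes of the relator word of lengths `k < l ≤ 4g` have different
values in `S_g`, unless `(k, l) = (0, 4g)`. [cite: ZieschangVogtColdewey1980, §5.4] -/
theorem proj_mk_take_ne {k l : ℕ} (hkl : k < l) (hl : l ≤ 4 * g) (hproper : ¬ (k = 0 ∧ l = 4 * g)) :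
    proj g (FreeGroup.mk ((surfaceWordStd g).take k)) ≠ proj g (FreeGroup.mk ((surfaceWordStd g).take l)) := by
  intro h
  rcases hl.lt_or_eq with hl | rfl
  · exact absurd (proj_mk_take_injective (hkl.trans hl) hl h) hkl.ne
  · have hk0 : k ≠ 0 := fun hk => hproper ⟨hk, rfl⟩
    rw [take_of_length_le (length_surfaceWordStd g).le, proj_mk_surfaceWordStd] at h
    have h0 : proj g (FreeGroup.mk ((surfaceWordStd g).take 0)) =
        proj g (FreeGroup.mk ((surfaceWordStd g).take k)) := by
      rw [h, take_zero, ← FreeGroup.one_eq_mk, map_one]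
    exact hk0 (proj_mk_take_injective (by omega) (by omega) h0).symm

/-- **Every proper contiguous sub-word of the relator word is non-trivial in `S_g`**: for
`k < l ≤ 4g` with `(k, l) ≠ (0, 4g)` the slice `r_g[k, l)` does not die in `S_g` — the closed
path reading `r_g` in the Cayley graph of `S_g` is simple. [cite: ZieschangVogtColdewey1980, §5.4] -/
theorem proj_mk_slice_surfaceWordStd_ne_one {g : ℕ} {k l : ℕ} (hkl : k < l) (hl : l ≤ 4 * g)
    (hproper : ¬ (k = 0 ∧ l = 4 * g)) :
    proj g (FreeGroup.mk (((surfaceWordStd g).drop k).take (l - k))) ≠ 1 := by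
  intro h
  refine proj_mk_take_ne hkl hl hproper ?_
  conv_rhs => rw [← Nat.add_sub_cancel' hkl.le, take_add]
  rw [← FreeGroup.mul_mk, map_mul, h, mul_one]

/-- **The relator word `r_g = ∏ [aᵢ, bᵢ]` is a simple circuit in the Cayley graph of `S_g`**
(`g ≥ 1`): non-empty, reduced, closed in `S_g`, with pairwise distinct proper prefixes.
[cite: ZieschangVogtColdewey1980, §5.4] -/
theorem isSimpleCircuit_surfaceWordStd {g : ℕ} (hg : 1 ≤ g) : IsSimpleCircuit (g := g) (surfaceWordStd g) := by
  refine ⟨fun h => ?_, isReduced_surfaceWordStd g, proj_mk_surfaceWordStd g, fun k l hkl hl => ?_⟩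
  · have := congrArg length h
    rw [length_surfaceWordStd, length_nil] at this
    omega
  · rw [length_surfaceWordStd] at hl
    exact proj_mk_take_ne hkl hl.le fun h' => absurd h'.2 hl.ne

end SurfaceGroup

end Literature.Topology.FourManifolds
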